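import Summits.ValiantsHypothesis.ValiantsHypothesis.Theorems.LacunarySymmetroidMatrixDescartesPivotRankOneCriticalWindowsLoneLetter

/-!
# `MatrixDescartes` census — rank-one `(2,K)₁`: THE FASTEST-LONE-LETTER LAW ON THE LEFT SIDE, ANY NUMBER OF LETTERS (by inversion)

HONEST FRAMING.  Object-search cell `pub-symmetroid`, seat `val-sym-mdr-p1` (generation 24); helper file `--supports` the crux item
stmt-ValiantsHypothesis-18050 (`Theses.LacunarySymmetroid.MatrixDescartes`, OPEN, on HOLD) with NO closure claim.  The mirror image of
`…LoneLetter.lone_letter_right` (all `K`), exactly as `…FourLoneLetterLeft` mirrors `…FourFoldCubic.lone_letter_four_right`: the INVERSION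
SYMMETRY `T ↦ 1/T`, `tₘ ↦ 1/tₘ`, `wₘ ↦ wₘtₘ²` maps the two critical equations to themselves up to the factors `∓1/T²` (`critical_inversion`)
and exchanges the two sides of the pivot.  Hence: pivot `p`, ONE lone letter `j` BELOW the pivot (`tⱼ < tₚ`) with the largest rate, all other
letters (at least one) above the pivot, pencil-coupled exponents, any positive weights ⇒ no three critical points with `0 < T₁ < T₂ < T₃ < tₚ`.
A COUNT for the lone-side cells of the rank-one `(2,K)₁` row (lone letter fastest), now on both sides; registers, the other splits,
`MatrixDescartes` in its window, `DoorA26`/`DoorA34`, credences, `VP ≠ VNP` untouched.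
[folklore] Change of variables.  No definitions, no named facts.
-/

-- `Summit.ValiantsHypothesis.ValiantsHypothesis.…` repeats a component by the D-0017 layout
-- (single-conjunct summit), which the `dupNamespace` linter flags; the name is mandated.
set_option linter.dupNamespace false

namespace Summit.ValiantsHypothesis.ValiantsHypothesis.Theorems.LacunarySymmetroidMatrixDescartes.Pivot.CriticalWindows.Lone

open Finset
open scoped BigOperators

/-- **INVERSION SYMMETRY OF THE CRITICAL EQUATIONS (any number of letters).**  With `T' = 1/T`, `tₘ' = 1/tₘ`, `wₘ' = wₘtₘ²`:
`∑ wₘ'x^{dₘ}(T'² − tₘ'²) = −T⁻²·∑ wₘx^{dₘ}(T² − tₘ²)` and `∑ βₘwₘ'x^{dₘ}(T' − tₘ')² = T⁻²·∑ βₘwₘx^{dₘ}(T − tₘ)²`; so a critical point stays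
critical. [folklore] -/
theorem critical_inversion {ι : Type*} (s : Finset ι) (β t w : ι → ℝ) (d : ι → ℕ) {x T : ℝ} (hT : T ≠ 0) (ht : ∀ m ∈ s, t m ≠ 0)
    (c : ∑ m ∈ s, w m * x ^ d m * (T ^ 2 - t m ^ 2) = 0) (c' : ∑ m ∈ s, β m * (w m * x ^ d m) * (T - t m) ^ 2 = 0) :
    ∑ m ∈ s, (w m * t m ^ 2) * x ^ d m * ((1 / T) ^ 2 - (1 / t m) ^ 2) = 0 ∧
    ∑ m ∈ s, β m * ((w m * t m ^ 2) * x ^ d m) * ((1 / T) - (1 / t m)) ^ 2 = 0 := by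
  constructor
  · have e : ∑ m ∈ s, (w m * t m ^ 2) * x ^ d m * ((1 / T) ^ 2 - (1 / t m) ^ 2)
        = -(1 / T ^ 2) * ∑ m ∈ s, w m * x ^ d m * (T ^ 2 - t m ^ 2) := by
      rw [Finset.mul_sum]
      refine Finset.sum_congr rfl fun m hm => ?_
      have h := ht m hm
      field_simp
      ring
    rw [e, c, mul_zero]
  · have e : ∑ m ∈ s, β m * ((w m * t m ^ 2) * x ^ d m) * ((1 / T) - (1 / t m)) ^ 2
        = (1 / T ^ 2) * ∑ m ∈ s, β m * (w m * x ^ d m) * (T - t m) ^ 2 := by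
      rw [Finset.mul_sum]
      refine Finset.sum_congr rfl fun m hm => ?_
      have h := ht m hm
      field_simp
      ring
    rw [e, c', mul_zero]

/-- **THE FASTEST-LONE-LETTER LAW (any number of letters, LEFT side): AT MOST TWO CRITICAL DIRECTIONS BELOW THE PIVOT LETTER.**  Pivot `p`
(rate `βₚ < 0`), lone letter `j` at `0 < tⱼ < tₚ` with the largest rate (`βₘ < βⱼ`, `m ≠ j`), all other letters (at least one) at `tₘ > tₚ` with
positive rates, exponents `dₘ − dₚ = λ(βₘ − βₚ)` (`λ > 0`), any positive weights: there are no three critical points with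
`0 < T₁ < T₂ < T₃ < tₚ`. [folklore] -/
theorem lone_letter_left {ι : Type*} (s : Finset ι) (β t w : ι → ℝ) (d : ι → ℕ) (p j : ι) (lam : ℝ)
    (hp : p ∈ s) (hj : j ∈ s) (hpj : p ≠ j) (hleft : ∃ m ∈ s, m ≠ p ∧ m ≠ j)
    (hw : ∀ m ∈ s, 0 < w m) (hβp : β p < 0) (hβ : ∀ m ∈ s, m ≠ p → 0 < β m) (hfast : ∀ m ∈ s, m ≠ j → β m < β j)
    (ht : ∀ m ∈ s, 0 < t m) (htp : ∀ m ∈ s, m ≠ p → m ≠ j → t p < t m) (hjp : t j < t p)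
    (hlam : 0 < lam) (hd : ∀ m ∈ s, (d m : ℝ) - (d p : ℝ) = lam * (β m - β p))
    {x₁ x₂ x₃ T₁ T₂ T₃ : ℝ} (hx₁ : 0 < x₁) (hx₂ : 0 < x₂) (hx₃ : 0 < x₃)
    (hT₁ : 0 < T₁) (h12 : T₁ < T₂) (h23 : T₂ < T₃) (h3p : T₃ < t p)
    (c₁ : ∑ m ∈ s, w m * x₁ ^ d m * (T₁ ^ 2 - t m ^ 2) = 0) (c₁' : ∑ m ∈ s, β m * (w m * x₁ ^ d m) * (T₁ - t m) ^ 2 = 0)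
    (c₂ : ∑ m ∈ s, w m * x₂ ^ d m * (T₂ ^ 2 - t m ^ 2) = 0) (c₂' : ∑ m ∈ s, β m * (w m * x₂ ^ d m) * (T₂ - t m) ^ 2 = 0)
    (c₃ : ∑ m ∈ s, w m * x₃ ^ d m * (T₃ ^ 2 - t m ^ 2) = 0) (c₃' : ∑ m ∈ s, β m * (w m * x₃ ^ d m) * (T₃ - t m) ^ 2 = 0) :
    False := by
  have hT₂ : 0 < T₂ := lt_trans hT₁ h12
  have hT₃ : 0 < T₃ := lt_trans hT₂ h23
  have htp0 : 0 < t p := ht p hp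
  have htne : ∀ m ∈ s, t m ≠ 0 := fun m hm => ne_of_gt (ht m hm)
  obtain ⟨e₁, e₁'⟩ := critical_inversion s β t w d (ne_of_gt hT₁) htne c₁ c₁'
  obtain ⟨e₂, e₂'⟩ := critical_inversion s β t w d (ne_of_gt hT₂) htne c₂ c₂'
  obtain ⟨e₃, e₃'⟩ := critical_inversion s β t w d (ne_of_gt hT₃) htne c₃ c₃'
  exact lone_letter_right s β (fun m => 1 / t m) (fun m => w m * t m ^ 2) d p j lam hp hj hpj hleft
    (fun m hm => mul_pos (hw m hm) (pow_pos (ht m hm) 2)) hβp hβ hfast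
    (fun m hm => one_div_pos.mpr (ht m hm)) (fun m hm hmp hmj => one_div_lt_one_div_of_lt htp0 (htp m hm hmp hmj))
    (one_div_lt_one_div_of_lt (ht j hj) hjp) hlam hd hx₃ hx₂ hx₁
    (one_div_lt_one_div_of_lt hT₃ h3p) (one_div_lt_one_div_of_lt hT₂ h23) (one_div_lt_one_div_of_lt hT₁ h12)
    e₃ e₃' e₂ e₂' e₁ e₁'

end Summit.ValiantsHypothesis.ValiantsHypothesis.Theorems.LacunarySymmetroidMatrixDescartes.Pivot.CriticalWindows.Lone
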